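import Summits.BirchSwinnertonDyer.BirchSwinnertonDyer.Theorems.QuadraticBranchSignedControlPlusEtaNonsurjThetaFunctionalEquationBranch
import Summits.BirchSwinnertonDyer.BirchSwinnertonDyer.Theorems.QuadraticBranchSignedControlPlusEtaNonsurjPlusCoeffCongruenceQuotientRange
import HarnessLib

/-!
# Route `QuadraticBranchSignedControl` (rung K8, cell `bsd-potss`), residual crux `PlusEtaMainConjectureNonsurj`
# (stmt-BirchSwinnertonDyer-19606): THE FUNCTIONAL EQUATION ON THE QUADRATIC BRANCH, VI — THE ORDER OF VANISHING AT `T = 0`: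
# `(−1)^{ord_T L_p^±(V,η,X)} = σ·(−N | p)` (`= w(W)`), `ord_T ≡ λ (mod 2)`, sign `−1 ⇒ L_p⁺(V,η,0) = 0`, sign `+1 ∧ L(0) = 0 ⇒ ord_T ≥ 2`
# (seat `bsd-potss-k8eta-c2` g27; kernel, class-wide; sequel of `…ThetaFunctionalEquationBranch`)

WHY. Part V (p761517) proved `ι L − w(1+T)^e L ∈ T·ω^±_n·Λ` for every branch function `L = L_p^±(V, η, X)` and EVERY `n`, and drew the
parity of the `λ`-invariant. The BSD-facing invariant is the ORDER OF VANISHING at `T = 0` (the character `χ = 1` of `Γ`, i.e. the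
`η`-twisted central value and its derivatives: `L_p⁺(V, η, 0) ∼ L(V ⊗ η, 1) = L(W, 1)`, Kobayashi (3.6)). THIS FILE proves
**`(−1)^{ord_T L} = σ·(−N | p)`** for every nonzero `L_p^±(V, η, X)` — so `ord_T L` has the parity of the analytic rank of the additive
partner `W` whenever `σ(−N|p) = w(W) = (−1)^{r_an(W)}` (the newform of `V` at level `N_V`) —, **`ord_T L ≡ λ(L) (mod 2)`**, and the two
BSD-shaped corollaries: sign `−1` ⇒ `L_p⁺(V, η, 0) = 0` (the `p`-adic functional equation SEES the forced central zero), and sign `+1`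
with `L(0) = 0` ⇒ `ord_T L ≥ 2` (an even positive order is at least `2`). No hypothesis on `μ`, on the image of `ρ_{V,p}`, on CM or on
the rank.

MATHEMATICS. §14: unlike `λ`, the order of vanishing needs EXACT coefficient identities, which the congruences `mod T·ω^±_nΛ` give only in
the limit: at `r = ord_T L`, `(ι L)_r = (−1)^r L_r` and `(wUL)_r = wL_r` exactly (`L_j = 0` for `j < r`; tree `coeff_order_subst`), while
`(T ω⁺_{2m} G)_r ∈ p^{m−i}ℤ_p` for `r ≤ p^{2i+1}(p−1)` (g26's `pow_dvd_coeff_X_mul_cyclotomicOmegaPlus_mul_of_le`; §15 proves the minus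
twin for `T ω⁻_{2m+1}` from `ω⁻_{2m+1} = Φ_p(1+T)∏_{t<m}Φ_{p^{2t+3}}(1+T)` and the Eisenstein property) — so `((−1)^r − w)L_r ∈ ∩_m p^{m−r}ℤ_p
= 0` (take `i = r`, `r ≤ p^{2r+1}(p−1)`), `L_r ≠ 0`, `(−1)^r = w`. §16 assembles with Part V.

WHAT. §14 `neg_one_pow_order_eq_of_forall_invol_sub_eq_mul` (generic); §15 `pow_dvd_coeff_cyclotomicOmegaMinus_two_mul_add_one_of_lt`,
`pow_dvd_coeff_X_mul_cyclotomicOmegaMinus_mul_of_le`; §16 `le_prime_pow_mul_pred`,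
**`neg_one_pow_order_eq_sign_of_isQuadraticBranch{Plus,Minus}LFunction`**,
`neg_one_pow_order_eq_neg_one_pow_lam_of_isQuadraticBranch{Plus,Minus}LFunction`,
**`constantCoeff_eq_zero_of_sign_eq_neg_one_of_isQuadraticBranchPlusLFunction`**,
**`two_le_order_of_sign_eq_one_of_constantCoeff_eq_zero_of_isQuadraticBranchPlusLFunction`**.

HONEST FRAMING (cell `bsd-potss`; FULL-BSD rank ≤ 1 programme, HUMAN RULING D-0036/D-0074): TOOL THEOREMS ONLY — no definition, no
named fact, no `sorry`, axioms standard; nothing about (A), (C1⁺_η), C-cc-1 or `BSD(W,p)` of any pair is claimed; no stub of 19606 is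
proved; crux and route OPEN; nothing booked. `--supports stmt-BirchSwinnertonDyer-19606`.

References: [MazurTateTeitelbaum1986Invent] §I.17; [Kobayashi2003] Thm. 3.2, (3.4)–(3.7); [GreenbergLNM1716] §5; [Pollack2003] §6.5,
Prop. 6.18; [Washington1997] §7.1, §13.2. Tree: Parts I–V; `…PlusCoeffCongruenceQuotientRange.lean` (g26), `…MinusCoeffCongruenceHigher.lean`
(g24: `pow_dvd_coeff_prod_range`), `PlusMinusPAdicLFunctionProofs.lean` (`cyclotomicOmegaMinus_two_mul_add_one_eq_prod`),
`Barriers/BirchSwinnertonDyer/PAdicFunctionalEquationParity.lean` (`coeff_order_subst`).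
-/

set_option autoImplicit false
set_option linter.dupNamespace false
noncomputable section

open scoped Classical MatrixGroups ModularForm

open CongruenceSubgroup Polynomial Literature.NumberTheory.EllipticCurves
  Literature.NumberTheory.EllipticCurves.ModularForms
open Literature.NumberTheory.EllipticCurves.IwasawaAlgebra
open Literature.Barriers.BirchSwinnertonDyer (coeff_order_subst)
open Summit.BirchSwinnertonDyer.Rank1Residual.Additive
open Summit.BirchSwinnertonDyer.Rank1Residual.X1.MuLambda (lam)

namespace Summit.BirchSwinnertonDyer.BirchSwinnertonDyer.Theorems.EtaThetaFunctionalEquation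

variable {p : ℕ} [hp : Fact p.Prime]

/-! ## §14 The ORDER OF VANISHING at `T = 0` has the parity of the sign: the generic `Λ`-lemma -/

/-- **Parity of `ord_{T=0}` from functional equations modulo arbitrarily `p`-divisible ideals.** Let `L ∈ Λ = ℤ_p⟦T⟧`, `L ≠ 0`,
`r = ord_T L`, `w ∈ ℤ`, and suppose that for EVERY `k` there are `U, D, G ∈ Λ` with `U(0) = 1`, `p^k ∣ D_i` for all `i ≤ r`, and
`ι L − w·U·L = D·G`. Then `(−1)^r = w`: the coefficient of `T^r` gives `((−1)^r − w)·L_r ∈ p^kℤ_p` for every `k` (exactly: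
`(ι L)_r = (−1)^r L_r` by `ord (ιT)^d ≥ d`, `(wUL)_r = w L_r`), hence `= 0`, and `L_r ≠ 0`.
[cite: GreenbergLNM1716, §5] [cite: Washington1997, §7.1 and §13.2] -/
theorem neg_one_pow_order_eq_of_forall_invol_sub_eq_mul {L : PowerSeries ℤ_[p]} (hL0 : L ≠ 0) {w : ℤ}
    (h : ∀ k : ℕ, ∃ (U D G : PowerSeries ℤ_[p]), PowerSeries.constantCoeff U = 1 ∧
      (∀ i ≤ L.order.toNat, (p : ℤ_[p]) ^ k ∣ PowerSeries.coeff i D) ∧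
      invol p L - PowerSeries.C (w : ℤ_[p]) * U * L = D * G) :
    (-1 : ℤ) ^ L.order.toNat = w := by
  have hP : p.Prime := hp.out
  set r := L.order.toNat with hr
  have hne : L.order ≠ ⊤ := fun h ↦ hL0 (PowerSeries.order_eq_top.mp h)
  have hord : L.order = (r : ℕ) := (ENat.coe_toNat hne).symm
  have hLr : PowerSeries.coeff r L ≠ 0 := (PowerSeries.order_eq_nat.mp hord).1
  -- exact identities for the `r`-th coefficients
  have h1 : PowerSeries.coeff r (invol p L) = PowerSeries.coeff r L * (-1) ^ r := by
    rw [invol_apply, coeff_order_subst (constantCoeff_invSubOne p) hord, coeff_one_invSubOne]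
  have h2 : ∀ U : PowerSeries ℤ_[p], PowerSeries.constantCoeff U = 1 →
      PowerSeries.coeff r (PowerSeries.C (w : ℤ_[p]) * U * L) = (w : ℤ_[p]) * PowerSeries.coeff r L := by
    intro U hU
    rw [mul_assoc, PowerSeries.coeff_C_mul, PowerSeries.coeff_mul]
    congr 1
    have hmem : ((0, r) : ℕ × ℕ) ∈ Finset.HasAntidiagonal.antidiagonal r := by simp
    rw [← Finset.add_sum_erase _ _ hmem, PowerSeries.coeff_zero_eq_constantCoeff_apply, hU, one_mul, add_eq_left]
    refine Finset.sum_eq_zero fun x hx ↦ ?_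
    rw [Finset.mem_erase, Finset.HasAntidiagonal.mem_antidiagonal] at hx
    have hx2 : x.2 < r := by
      rcases Nat.lt_or_ge x.2 r with h' | h'
      · exact h'
      · exfalso; apply hx.1; ext <;> simp <;> omega
    rw [PowerSeries.coeff_of_lt_order x.2 (by rw [hord]; exact_mod_cast hx2), mul_zero]
  -- `((−1)^r − w) L_r ∈ p^k ℤ_p` for every `k`
  have h3 : ∀ k : ℕ, (p : ℤ_[p]) ^ k ∣ ((-1 : ℤ_[p]) ^ r - w) * PowerSeries.coeff r L := by
    intro k
    obtain ⟨U, D, G, hU, hD, hFE⟩ := h k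
    have hc := congr_arg (PowerSeries.coeff r) hFE
    rw [map_sub, h1, h2 U hU, PowerSeries.coeff_mul] at hc
    rw [show ((-1 : ℤ_[p]) ^ r - w) * PowerSeries.coeff r L =
      PowerSeries.coeff r L * (-1) ^ r - (w : ℤ_[p]) * PowerSeries.coeff r L by ring, hc]
    refine Finset.dvd_sum fun x hx ↦ ?_
    rw [Finset.HasAntidiagonal.mem_antidiagonal] at hx
    exact Dvd.dvd.mul_right (hD x.1 (by omega)) _
  -- hence `= 0`
  have h4 : ((-1 : ℤ_[p]) ^ r - w) * PowerSeries.coeff r L = 0 := by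
    by_contra hx
    have h5 := h3 ((((-1 : ℤ_[p]) ^ r - w) * PowerSeries.coeff r L).valuation + 1)
    have h6 := (PadicInt.mem_span_pow_iff_le_valuation _ hx _).mp (Ideal.mem_span_singleton.mpr h5)
    omega
  have h7 : ((-1 : ℤ_[p]) ^ r - w) = 0 := (mul_eq_zero.mp h4).resolve_right hLr
  have h8 : (((-1) ^ r - w : ℤ) : ℤ_[p]) = 0 := by push_cast; exact h7
  have h9 : ((-1) ^ r - w : ℤ) = 0 := by exact_mod_cast h8
  linear_combination h9

/-! ## §15 `p^{m−i} ∣ (ω⁻_{2m+1})_j` in the wide range (minus twin of g26's `pow_dvd_coeff_cyclotomicOmegaPlus_two_mul_of_lt`) -/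

/-- **`p^{m−i} ∣ (ω⁻_{2m+1})_j` for every `j < p^{2i+1}(p−1)`** (`i ≤ m`): in `ω⁻_{2m+1} = Φ_p(1+T)·∏_{t<m}Φ_{p^{2t+3}}(1+T)` the `m − i`
factors with `t ≥ i` are Eisenstein of degree `p^{2t+2}(p−1) > p^{2i+1}(p−1)`. [cite: Pollack2003, §6.5 (display before Prop. 6.18)]
[cite: Washington1997, §7.1] -/
theorem pow_dvd_coeff_cyclotomicOmegaMinus_two_mul_add_one_of_lt (m i : ℕ) (hi : i ≤ m) :
    ∀ j < p ^ (2 * i + 1) * (p - 1), (p : ℤ) ^ (m - i) ∣ (cyclotomicOmegaMinus p (2 * m + 1)).coeff j := by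
  have hP := hp.out
  set F : ℕ → ℤ[X] := fun k ↦ (cyclotomic (p ^ (2 * k + 3)) ℤ).comp (X + 1) with hF
  have hsplit : cyclotomicOmegaMinus p (2 * m + 1) =
      ((cyclotomic p ℤ).comp (X + 1) * ∏ k ∈ Finset.range i, F k) * ∏ t ∈ Finset.range (m - i), F (i + t) := by
    rw [cyclotomicOmegaMinus_two_mul_add_one_eq_prod, mul_assoc, ← Finset.prod_range_mul_prod_Ico F hi,
      Finset.prod_Ico_eq_prod_range]
  rw [hsplit]
  refine EtaPlusCoeffCongruence.dvd_coeff_mul_of_forall_dvd_coeff ?_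
  refine EtaMinusCoeffCongruence.pow_dvd_coeff_prod_range (fun t ↦ F (i + t)) (fun t j hj ↦ ?_) (m - i)
  have h := EtaPlusCoeffCongruence.dvd_coeff_cyclotomic_prime_pow_succ_comp_X_add_one (p := p) (2 * (i + t) + 2) j ?_
  · rw [hF]
    dsimp only
    rw [show 2 * (i + t) + 3 = 2 * (i + t) + 2 + 1 by ring]
    exact h
  · calc j < p ^ (2 * i + 1) * (p - 1) := hj
      _ ≤ p ^ (2 * (i + t) + 2) * (p - 1) :=
          Nat.mul_le_mul_right _ (Nat.pow_le_pow_right hP.pos (by omega))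

/-- **`p^{m−i} ∣ (T·ω⁻_{2m+1}·q)_k` for every `q ∈ Λ` and every `k ≤ p^{2i+1}(p−1)`** (`i ≤ m`); minus twin of g26's
`pow_dvd_coeff_X_mul_cyclotomicOmegaPlus_mul_of_le`. [cite: Pollack2003, §6.5 (display before Prop. 6.18)] -/
theorem pow_dvd_coeff_X_mul_cyclotomicOmegaMinus_mul_of_le (m i : ℕ) (hi : i ≤ m) (q : IwasawaAlgebra p) {k : ℕ}
    (hk : k ≤ p ^ (2 * i + 1) * (p - 1)) :
    (p : ℤ_[p]) ^ (m - i) ∣ PowerSeries.coeff k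
      ((((X * cyclotomicOmegaMinus p (2 * m + 1)).map (Int.castRingHom ℤ_[p]) : ℤ_[p][X]) : PowerSeries ℤ_[p]) * q) := by
  rw [PowerSeries.coeff_mul]
  refine Finset.dvd_sum fun x hx ↦ ?_
  have hsum : x.1 + x.2 = k := Finset.HasAntidiagonal.mem_antidiagonal.mp hx
  refine Dvd.dvd.mul_right ?_ _
  rw [Polynomial.coeff_coe, Polynomial.coeff_map]
  rcases Nat.eq_zero_or_pos x.1 with h0 | hpos
  · rw [h0, Polynomial.coeff_X_mul_zero, map_zero]
    exact dvd_zero _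
  · obtain ⟨j, hj⟩ : ∃ j, x.1 = j + 1 := ⟨x.1 - 1, by omega⟩
    rw [hj, Polynomial.coeff_X_mul]
    have hdvd := pow_dvd_coeff_cyclotomicOmegaMinus_two_mul_add_one_of_lt (p := p) m i hi j (by omega)
    have h := map_dvd (Int.castRingHom ℤ_[p]) hdvd
    rwa [map_pow, map_natCast] at h

/-! ## §16 `(−1)^{ord_{T=0} L_p^±(V,η,X)} = σ·(−N | p)`; `ord ≡ λ (mod 2)`; vanishing at `T = 0` when the sign is `−1` -/

section Branch

variable {N : ℕ} [NeZero N] {f : CuspForm (Gamma0 N) 2}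

omit hp in
/-- `r ≤ p^{2r+1}(p−1)` for a prime `p`. [folklore] -/
theorem le_prime_pow_mul_pred [Fact p.Prime] (r : ℕ) : r ≤ p ^ (2 * r + 1) * (p - 1) := by
  have hP : p.Prime := Fact.out
  have h1 : r < p ^ (2 * r + 1) := lt_of_lt_of_le (Nat.lt_pow_self hP.one_lt) (Nat.pow_le_pow_right hP.pos (by omega))
  have h2 : 1 ≤ p - 1 := by have := hP.two_le; omega
  calc r ≤ p ^ (2 * r + 1) := h1.le
    _ = p ^ (2 * r + 1) * 1 := (mul_one _).symm
    _ ≤ p ^ (2 * r + 1) * (p - 1) := Nat.mul_le_mul_left _ h2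

/-- **PARITY OF THE ORDER OF VANISHING of `L_p⁺(V, η, X)` at `T = 0`.** For `p` odd, `f` a rational newform of level `N` prime to `p` with
`a_p(f) = 0`, Fricke sign `σ`, `‖ϖ‖_p ≤ 1`, and any NONZERO plus branch function `L`: `(−1)^{ord_{T=0} L} = σ·(−N | p)` (`= w(W)` for the
newform of `V` at level `N_V`). [cite: MazurTateTeitelbaum1986Invent, §I.17] [cite: GreenbergLNM1716, §5] [cite: Kobayashi2003, Thm. 3.2, (3.4)] -/
theorem neg_one_pow_order_eq_sign_of_isQuadraticBranchPlusLFunction (hp2 : p ≠ 2) (hf0 : IsNewform0 f)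
    (hQ : coeffField f = ⊥) (hpN : ¬ p ∣ N) (hap : cuspCoeff f p = ((0 : ℤ) : ℂ)) {σ : ℤ} (hσ : σ ^ 2 = 1)
    (hW : atkinLehnerInvolution N 2 N f = (-(σ : ℂ)) • f) {ϖ : ℚ} (hϖ : ‖(ϖ : ℚ_[p])‖ ≤ 1)
    {L : IwasawaAlgebra p} (hL : IsQuadraticBranchPlusLFunction f p ϖ L) (hL0 : L ≠ 0) :
    (-1 : ℤ) ^ L.order.toNat = σ * legendreSym p (-(N : ℤ)) := by
  set r := L.order.toNat with hr
  refine neg_one_pow_order_eq_of_forall_invol_sub_eq_mul hL0 fun k ↦ ?_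
  obtain ⟨e, G, hG⟩ :=
    exists_invol_sub_sign_mul_eq_of_isQuadraticBranchPlusLFunction hp2 hf0 hQ hpN hap hσ hW hϖ hL (k + r)
  refine ⟨(1 + PowerSeries.X) ^ e, _, G, by rw [map_pow, map_add, map_one, PowerSeries.constantCoeff_X, add_zero, one_pow],
    fun i hi ↦ ?_, hG⟩
  have h := EtaPlusCoeffCongruence.pow_dvd_coeff_X_mul_cyclotomicOmegaPlus_mul_of_le (p := p) (k + r) r (Nat.le_add_left r k) 1
    (k := i) (hi.trans (le_prime_pow_mul_pred r))
  rwa [mul_one, Nat.add_sub_cancel] at h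

/-- **PARITY OF THE ORDER OF VANISHING of `L_p⁻(V, η, X)` at `T = 0`** (twin). [cite: MazurTateTeitelbaum1986Invent, §I.17]
[cite: GreenbergLNM1716, §5] [cite: Kobayashi2003, Thm. 3.2, (3.5)] -/
theorem neg_one_pow_order_eq_sign_of_isQuadraticBranchMinusLFunction (hp2 : p ≠ 2) (hf0 : IsNewform0 f)
    (hQ : coeffField f = ⊥) (hpN : ¬ p ∣ N) (hap : cuspCoeff f p = ((0 : ℤ) : ℂ)) {σ : ℤ} (hσ : σ ^ 2 = 1)
    (hW : atkinLehnerInvolution N 2 N f = (-(σ : ℂ)) • f) {ϖ : ℚ} (hϖ : ‖(ϖ : ℚ_[p])‖ ≤ 1)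
    {L : IwasawaAlgebra p} (hL : IsQuadraticBranchMinusLFunction f p ϖ L) (hL0 : L ≠ 0) :
    (-1 : ℤ) ^ L.order.toNat = σ * legendreSym p (-(N : ℤ)) := by
  set r := L.order.toNat with hr
  refine neg_one_pow_order_eq_of_forall_invol_sub_eq_mul hL0 fun k ↦ ?_
  obtain ⟨e, G, hG⟩ :=
    exists_invol_sub_sign_mul_eq_of_isQuadraticBranchMinusLFunction hp2 hf0 hQ hpN hap hσ hW hϖ hL (k + r)
  refine ⟨(1 + PowerSeries.X) ^ e, _, G, by rw [map_pow, map_add, map_one, PowerSeries.constantCoeff_X, add_zero, one_pow],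
    fun i hi ↦ ?_, hG⟩
  have h := pow_dvd_coeff_X_mul_cyclotomicOmegaMinus_mul_of_le (p := p) (k + r) r (Nat.le_add_left r k) 1
    (k := i) (hi.trans (le_prime_pow_mul_pred r))
  rwa [mul_one, Nat.add_sub_cancel] at h

/-- **`ord_{T=0} ≡ λ (mod 2)`** for every nonzero `L_p⁺(V, η, X)` (both have the parity of the sign).
[cite: GreenbergLNM1716, §5] [cite: Washington1997, §7.1] -/
theorem neg_one_pow_order_eq_neg_one_pow_lam_of_isQuadraticBranchPlusLFunction (hp2 : p ≠ 2) (hf0 : IsNewform0 f)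
    (hQ : coeffField f = ⊥) (hpN : ¬ p ∣ N) (hap : cuspCoeff f p = ((0 : ℤ) : ℂ)) {ϖ : ℚ} (hϖ : ‖(ϖ : ℚ_[p])‖ ≤ 1)
    {L : IwasawaAlgebra p} (hL : IsQuadraticBranchPlusLFunction f p ϖ L) (hL0 : L ≠ 0) :
    (-1 : ℤ) ^ L.order.toNat = (-1) ^ lam L := by
  obtain ⟨σ, hσ, hW⟩ := exists_frickeSign_of_isNewform0 hf0
  rw [neg_one_pow_order_eq_sign_of_isQuadraticBranchPlusLFunction hp2 hf0 hQ hpN hap hσ hW hϖ hL hL0,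
    neg_one_pow_lam_eq_sign_of_isQuadraticBranchPlusLFunction hp2 hf0 hQ hpN hap hσ hW hϖ hL hL0]

/-- **`ord_{T=0} ≡ λ (mod 2)`** for every nonzero `L_p⁻(V, η, X)`. [cite: GreenbergLNM1716, §5] [cite: Washington1997, §7.1] -/
theorem neg_one_pow_order_eq_neg_one_pow_lam_of_isQuadraticBranchMinusLFunction (hp2 : p ≠ 2) (hf0 : IsNewform0 f)
    (hQ : coeffField f = ⊥) (hpN : ¬ p ∣ N) (hap : cuspCoeff f p = ((0 : ℤ) : ℂ)) {ϖ : ℚ} (hϖ : ‖(ϖ : ℚ_[p])‖ ≤ 1)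
    {L : IwasawaAlgebra p} (hL : IsQuadraticBranchMinusLFunction f p ϖ L) (hL0 : L ≠ 0) :
    (-1 : ℤ) ^ L.order.toNat = (-1) ^ lam L := by
  obtain ⟨σ, hσ, hW⟩ := exists_frickeSign_of_isNewform0 hf0
  rw [neg_one_pow_order_eq_sign_of_isQuadraticBranchMinusLFunction hp2 hf0 hQ hpN hap hσ hW hϖ hL hL0,
    neg_one_pow_lam_eq_sign_of_isQuadraticBranchMinusLFunction hp2 hf0 hQ hpN hap hσ hW hϖ hL hL0]

/-- **SIGN `−1` FORCES VANISHING AT `T = 0`**: if `σ·(−N | p) = −1` then every plus branch function has `L(0) = 0` — for the newform of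
`V` at level `N_V` (`w(W) = −1`) this is `L_p⁺(V, η, 0) = 0`, i.e. (Kobayashi (3.6)) the vanishing of `∑_{a mod p} η(a)[a/p]^δ_f ∼ L(V ⊗ η, 1)`
read off the `p`-adic functional equation. [cite: Kobayashi2003, (3.6) (p. 7)] [cite: MazurTateTeitelbaum1986Invent, §I.17] -/
theorem constantCoeff_eq_zero_of_sign_eq_neg_one_of_isQuadraticBranchPlusLFunction (hp2 : p ≠ 2) (hf0 : IsNewform0 f)
    (hQ : coeffField f = ⊥) (hpN : ¬ p ∣ N) (hap : cuspCoeff f p = ((0 : ℤ) : ℂ)) {σ : ℤ} (hσ : σ ^ 2 = 1)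
    (hW : atkinLehnerInvolution N 2 N f = (-(σ : ℂ)) • f) (hsign : σ * legendreSym p (-(N : ℤ)) = -1)
    {ϖ : ℚ} (hϖ : ‖(ϖ : ℚ_[p])‖ ≤ 1) {L : IwasawaAlgebra p} (hL : IsQuadraticBranchPlusLFunction f p ϖ L) :
    PowerSeries.constantCoeff L = 0 := by
  by_cases hL0 : L = 0
  · rw [hL0, map_zero]
  have h := neg_one_pow_order_eq_sign_of_isQuadraticBranchPlusLFunction hp2 hf0 hQ hpN hap hσ hW hϖ hL hL0
  rw [hsign] at h
  have hodd : Odd L.order.toNat := by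
    rcases Nat.even_or_odd L.order.toNat with he | ho
    · rw [he.neg_one_pow] at h; norm_num at h
    · exact ho
  have hpos : 1 ≤ L.order.toNat := hodd.pos
  have hne : L.order ≠ ⊤ := fun h' ↦ hL0 (PowerSeries.order_eq_top.mp h')
  rw [← PowerSeries.coeff_zero_eq_constantCoeff_apply]
  exact PowerSeries.coeff_of_lt_order 0 (by rw [← ENat.coe_toNat hne]; exact_mod_cast hpos)

/-- **SIGN `+1` AND VANISHING AT `T = 0` FORCE `ord_{T=0} ≥ 2`** (plus branch function): the `p`-adic shadow of «even analytic rank `≥ 1`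
is `≥ 2`». [cite: GreenbergLNM1716, §5] [cite: MazurTateTeitelbaum1986Invent, §I.17] -/
theorem two_le_order_of_sign_eq_one_of_constantCoeff_eq_zero_of_isQuadraticBranchPlusLFunction (hp2 : p ≠ 2)
    (hf0 : IsNewform0 f) (hQ : coeffField f = ⊥) (hpN : ¬ p ∣ N) (hap : cuspCoeff f p = ((0 : ℤ) : ℂ)) {σ : ℤ}
    (hσ : σ ^ 2 = 1) (hW : atkinLehnerInvolution N 2 N f = (-(σ : ℂ)) • f) (hsign : σ * legendreSym p (-(N : ℤ)) = 1)
    {ϖ : ℚ} (hϖ : ‖(ϖ : ℚ_[p])‖ ≤ 1) {L : IwasawaAlgebra p} (hL : IsQuadraticBranchPlusLFunction f p ϖ L) (hL0 : L ≠ 0)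
    (h0 : PowerSeries.constantCoeff L = 0) : 2 ≤ L.order.toNat := by
  have h := neg_one_pow_order_eq_sign_of_isQuadraticBranchPlusLFunction hp2 hf0 hQ hpN hap hσ hW hϖ hL hL0
  rw [hsign] at h
  have hne : L.order ≠ ⊤ := fun h' ↦ hL0 (PowerSeries.order_eq_top.mp h')
  have h1 : ((1 : ℕ) : ℕ∞) ≤ L.order := PowerSeries.nat_le_order L 1 fun i hi ↦ by
    have hi0 : i = 0 := by omega
    rw [hi0, PowerSeries.coeff_zero_eq_constantCoeff, h0]
  rw [← ENat.coe_toNat hne] at h1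
  have hpos : 1 ≤ L.order.toNat := by exact_mod_cast h1
  rcases Nat.even_or_odd L.order.toNat with he | ho
  · obtain ⟨k, hk⟩ := he; omega
  · rw [ho.neg_one_pow] at h; norm_num at h

end Branch

end Summit.BirchSwinnertonDyer.BirchSwinnertonDyer.Theorems.EtaThetaFunctionalEquation

end
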